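import Summits.QuantumFields.BalabanUV.T4Continuum.Spine.NE1p.DressedSmallFieldMixedDifferenceClosedForm
import Summits.QuantumFields.BalabanUV.T4Continuum.Spine.NE1p.DressedSmallFieldMixedDerivativeSplitLocal

/-!
# T⁴ programme, spine estimate NE1′ (node O3b/H2) — THE SUBSTRATE's `J`-INDEXED FULL LETTER, TRANSPORTED: for ANY finite cube index `J` (row NE5's
# `Support/B13TermContours` §2: `lamJ J`, `wJ`, `sigmaJ`), `∫ wJ r q·F(sigmaJ r q) dlamJ(J)` equals, through ANY enumeration `e : J ≃ Fin n`, W39.1's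
# `Fin n`-letter of `F ∘ (· ∘ e)` — hence the MIXED DIFFERENCE `Δ_univ` (entire OR local hypothesis), W76's ENUMERATION-FREE inclusion–exclusion sum
# `Σ_{T ⊆ J} (−1)^{#J−#T}·F(𝟙_T)`, and (2.15)'s decay `A·e^{−(κ₁−1)·#J}`; no numbering of the cubes enters

Cell `pub-balaban`, sub-cell `t4`, row NE1′ formalisation crew (`t4/formal/NE1p/LEAVES.md` row W95 ∕ DAG N29zzzzzh, BOOKED typer R-T151 journal
l.24469, cap 220, X-read X238 — own-initiative DICTIONARY follower of the unit's W76 «THE MIXED DIFFERENCE IN CLOSED FORM» (§3 index-free transport of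
`Δ_S`) and W74 «SplitLocal» under R-T61 (ii); g11∕g12's recorded NATURAL NEXT (b) «transport of the CONTOUR letter along `ι ≃ Fin n` via
`measurePreserving_piCongrLeft`»), unit `b2b-balaban-t4-ne1p-formalise-leaf-08` (gen 13).  ADDITIVE — imports W76 `Spine/NE1p/DressedSmallFieldMixedDifferenceClosedForm` (`mixedDiff_transport_eq_sum`) + W74
`Spine/NE1p/DressedSmallFieldMixedDerivativeSplitLocal` (`mixedLetter_rep_of_split_local`, `norm_mixedDiff_le_lemma19`) ONLY (→ W39.1 `mixedDiff`,
`mixedLetter_rep_univ`, `pi_μS_univ`∕`wS_univ`∕`σS_univ`; W55 `analyticOnNhd_apply`; the NE5 substrate `Support/B13TermContours` §2: `lam₁`, `lamJ`,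
`wJ`, `sigmaJ`, `circ`, `w₁`; the template's `polydisc` — BY NAME) + Mathlib (`MeasureTheory.measurePreserving_piCongrLeft`,
`MeasurableEquiv.piCongrLeft`, `Equiv.piCongrLeft_apply_eq_cast`, `MeasurePreserving.integral_comp`, `Fintype.prod_equiv`, `Fintype.equivFin`,
`Finset.map_univ_equiv`).  THEOREMS ONLY + one decided `example`; 0 `def`, 0 `instance`, 0 `def … : Prop`, 0 cite, 0 sorry, 0 `attribute`; nothing of
the substrate ∕ W39.1 ∕ W74 ∕ W76 restated.

WHY THIS FILE.  [Balaban1988RGII]'s cubes are indexed by SETS of cubes (`Δ ⊂ Y₀∖□̃⁴` in (1.23) p. 7, `Δ ⊂ Z∖Z̃′₀` in (2.8) p. 14, `□ ⊂ Z−Y` in the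
template [Dimock2013] (summer)) — no numbering; the substrate's contour SPACE is accordingly `J`-indexed for an arbitrary finite `J` (`lamJ J`,
`wJ`, `sigmaJ`), while the lineage's DICTIONARY (`mixedDiff n S`, the letters of W39.1∕W43∕W55∕W57∕W62∕W70∕W74, W89) is `Fin n`-indexed; W39.1's
`mixedLetter_rep_univ` reaches the substrate only at `J = Fin n`, and W76 §3 transported the DIFFERENCE `Δ_S` along `ι ≃ Fin n` but not the LETTER.
Here the letter itself is transported (LOCI above are TYPE∕CONTEXT only):
* §1 **`measurePreserving_reindex`**: `q ↦ q ∘ e⁻¹` pushes `lamJ J` to `lamJ (Fin n)` (Mathlib `measurePreserving_piCongrLeft`; the `cast` of the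
  constant family is trivial, `piCongrLeft_apply_eq`); `wJ_reindex`, `sigmaJ_reindex`; **`letterJ_eq_letter_fin`**: `∫ wJ r q·F(sigmaJ r q) dlamJ(J)
  = ∫ wJ (r∘e⁻¹) p·F(sigmaJ (r∘e⁻¹) p ∘ e) dlamJ(Fin n)` for EVERY `F` (change of variables along a measurable EQUIVALENCE — no integrability needed);
* §2 **`letterJ_rep`** (entire `F`, W39.1 `mixedLetter_rep_univ`) and **`letterJ_rep_local`** (`F` analytic on the open `J`-polydisc `Π_j{|z_j| < R_j}`,
  radii `1 < r_j < R_j`; «SplitLocal» at `S = univ` through `pi_μS_univ`∕`wS_univ`∕`σS_univ`): `= Δ_univ (z ↦ F(z ∘ e))`; `differentiable_reindex`,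
  `analyticOnNhd_reindex` (the re-indexing is a continuous linear map of the polydiscs);
* §3 **`letterJ_eq_sum_local`**: `= Σ_{T ⊆ J} (−1)^{#J − #T}·F(𝟙_T)` — W76 `mixedDiff_transport_eq_sum` at `S = univ` (`Finset.map_univ_equiv`): NO
  ENUMERATION on either side; **`letterJ_rep_indep`**: two enumerations give the same `Δ_univ`;
* §4 **`norm_letterJ_le`**: `κ₁ ≥ 1`, `1 < r_j < R_j`, `R_j > e^{κ₁}`, `‖F‖ ≤ A` on the closed `J`-polydisc `|z_j| ≤ e^{κ₁}` (HYPOTHESIS of (1.18)∕(1.21) TYPE)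
  ⇒ `|letter| ≤ A·e^{−(κ₁−1)·#J}` — (2.15)'s∕(1.24)'s «exp(−(κ₁ − 1)·#cubes)» (TYPE) read on the substrate's own `J`-indexed space («SplitLocal»
  `norm_mixedDiff_le_lemma19` = Dimock's Lemma 19 BY NAME on the re-indexed factor, `Fintype.card_fin`);
* §5 decided, on the NON-numeric index `J = Bool`: `F(z) = z_true·z_false`, radii `3∕2 < 2`: the substrate's letter `= F(𝟙_{univ}) − F(𝟙_{true}) −
  F(𝟙_{false}) + F(𝟙_∅) = 1` (`analyticOnNhd_eval`; the powerset of `univ : Finset Bool` DECIDED).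

HONEST FRAMING.  [folklore] measure theory (change of variables along `piCongrLeft`) + the lineage's kernel analysis BY NAME on the substrate's
contour OBJECTS and OUR dictionary; a DICTIONARY∕CONSISTENCY row — the `J`-indexed letter of row NE5's substrate gets W39.1–W89's dictionary with no
choice of numbering mattering; NOT an estimate of print: `F` ↔ print's s(Δ)-dependent operator products, radii ↔ `|σ(Δ)| = e^{κ₁}`, `J` ↔ `Y₀∖□̃⁴` ∕
`Z∖Z̃′₀` are TYPE READINGS; `A` is a HYPOTHESIS of (1.18)∕(1.21) TYPE; no numeral of [Balaban1988RGII] asserted (k2); (B1) for Bałaban's (2.14) NOT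
discharged; (B3) = GAPS G-ne9p2-5 UNPRINTED — NOT discharged, untouched; (B5) untouched; 0 binders instantiated on Bałaban's densities ∕ operators ∕
(2.14) data ∕ `d_k` ∕ minimisers ∕ backgrounds; discharges no wall item; wall v1.8 (T4-DAG v48) does NOT move; R-t4r2-Q2 NOT met thereby; NE1′ ⇐ the
named binders — NOT proved, NOT printed; spine PROVED 0∕9; count 9 unchanged.  Rung (B)+1 on ONE finite four-torus — NOT infinite volume, NOT a mass
gap, NOT OS on ℝ⁴, NOT Clay.  ABSOLUTE RULE honoured: the loci of the audited manuscript [Balaban1988RGII] (CMP 116 (1988) 1–22, pp. 7, 14) are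
TYPE∕CONTEXT only, never hypothesis-free facts; [Dimock2013] enters only through the cite-tagged Literature module BY NAME; nothing internally minted
is cited; [folklore] tags on kernel lemmas only.  HONEST DEPENDENCY: continuum YM on T⁴ ⇐ BetaPertH ∧ nine spine estimates (0/9 proved); BetaPertH ⇐
(D1) ∧ (D4) ∧ CAP+tail; G-an2-4 gates asym, D1 and NE2/3/4.
-/

noncomputable section

namespace Summit.QuantumFields.BalabanUV.T4Continuum.NE1p.DressedSmallFieldLetterTransport

open MeasureTheory Metric Set Complex Finset Function
open scoped BigOperators
open Summit.QuantumFields.BalabanUV.T4Continuum.B13TermContours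
open Summit.QuantumFields.BalabanUV.T4Continuum.NE1p.DressedSmallFieldMixedLetter
open Summit.QuantumFields.BalabanUV.T4Continuum.NE1p.DressedSmallFieldMixedDerivativeBridge (analyticOnNhd_apply)
open Summit.QuantumFields.BalabanUV.T4Continuum.NE1p.DressedSmallFieldMixedDerivativeSplitLocal (mixedLetter_rep_of_split_local norm_mixedDiff_le_lemma19)
open Summit.QuantumFields.BalabanUV.T4Continuum.NE1p.DressedSmallFieldMixedDifferenceClosedForm (mixedDiff_transport_eq_sum)
open Literature.MathematicalPhysics.QuantumFieldTheory.Dimock2011to13.PolydiscCauchyBounds (polydisc)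

variable {n : ℕ} {J : Type*} [Fintype J]

/-! ## §1 Transport of the substrate's objects along an enumeration `e : J ≃ Fin n` -/

/-- [folklore] The substrate's product weight is invariant under re-indexing: `wJ (r ∘ e⁻¹) (q ∘ e⁻¹) = wJ r q` (`Fintype.prod_equiv`). -/
theorem wJ_reindex (e : J ≃ Fin n) (r : J → ℝ) (q : J → ℝ × ℝ) : wJ (r ∘ e.symm) (q ∘ e.symm) = wJ r q := by
  unfold wJ
  exact (Fintype.prod_equiv e _ _ fun j => by simp).symm

omit [Fintype J] in
/-- [folklore] … and the contour configuration re-indexes pointwise: `sigmaJ (r ∘ e⁻¹) (q ∘ e⁻¹) ∘ e = sigmaJ r q`. -/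
theorem sigmaJ_reindex (e : J ≃ Fin n) (r : J → ℝ) (q : J → ℝ × ℝ) : sigmaJ (r ∘ e.symm) (q ∘ e.symm) ∘ e = sigmaJ r q := by
  funext j; simp [sigmaJ]

omit [Fintype J] in
/-- [folklore] Re-indexing the parameters `q ↦ q ∘ e⁻¹` is Mathlib's `MeasurableEquiv.piCongrLeft` (constant family: the `cast` is trivial). -/
theorem piCongrLeft_apply_eq (e : J ≃ Fin n) (q : J → ℝ × ℝ) :
    (MeasurableEquiv.piCongrLeft (fun _ : Fin n => ℝ × ℝ) e) q = q ∘ e.symm := by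
  funext a
  rw [MeasurableEquiv.coe_piCongrLeft, Function.comp_apply, Equiv.piCongrLeft_apply_eq_cast, cast_eq]

/-- **THE PARAMETER MEASURE TRANSPORTS** [folklore]: `q ↦ q ∘ e⁻¹` pushes the substrate's `lamJ J` to `lamJ (Fin n)` (Mathlib
`measurePreserving_piCongrLeft`). -/
theorem measurePreserving_reindex (e : J ≃ Fin n) :
    MeasurePreserving (fun q : J → ℝ × ℝ => q ∘ e.symm) (lamJ J) (lamJ (Fin n)) := by
  have h := measurePreserving_piCongrLeft (fun _ : Fin n => (lam₁ : Measure (ℝ × ℝ))) e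
  have hfun : (⇑(MeasurableEquiv.piCongrLeft (fun _ : Fin n => ℝ × ℝ) e)) = fun q : J → ℝ × ℝ => q ∘ e.symm :=
    funext (piCongrLeft_apply_eq e)
  rw [hfun] at h
  exact h

/-- **THE `J`-LETTER IS THE `Fin n`-LETTER OF THE RE-INDEXED FACTOR** [folklore] (change of variables along the measurable EQUIVALENCE — no
integrability hypothesis): `∫ wJ r q·F(sigmaJ r q) dlamJ(J) = ∫ wJ (r∘e⁻¹) p·F(sigmaJ (r∘e⁻¹) p ∘ e) dlamJ(Fin n)`. -/
theorem letterJ_eq_letter_fin (e : J ≃ Fin n) (r : J → ℝ) (F : (J → ℂ) → ℂ) :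
    ∫ q, wJ r q * F (sigmaJ r q) ∂(lamJ J) = ∫ p, wJ (r ∘ e.symm) p * F (sigmaJ (r ∘ e.symm) p ∘ e) ∂(lamJ (Fin n)) := by
  have hme : MeasurableEmbedding fun q : J → ℝ × ℝ => q ∘ e.symm := by
    have h := (MeasurableEquiv.piCongrLeft (fun _ : Fin n => ℝ × ℝ) e).measurableEmbedding
    rwa [show (⇑(MeasurableEquiv.piCongrLeft (fun _ : Fin n => ℝ × ℝ) e)) = fun q : J → ℝ × ℝ => q ∘ e.symm from
      funext (piCongrLeft_apply_eq e)] at h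
  rw [← (measurePreserving_reindex e).integral_comp hme]
  refine integral_congr_ae (Filter.Eventually.of_forall fun q => ?_)
  simp only [wJ_reindex, sigmaJ_reindex]

/-! ## §2 … HENCE THE MIXED DIFFERENCE, under the entire and under the LOCAL hypothesis -/

/-- [folklore] Re-indexing the factor preserves joint entireness. -/
theorem differentiable_reindex (e : J ≃ Fin n) {F : (J → ℂ) → ℂ} (hF : Differentiable ℂ F) :
    Differentiable ℂ fun z : Fin n → ℂ => F (z ∘ e) :=
  hF.comp (ContinuousLinearMap.differentiable
    (ContinuousLinearMap.pi fun j => ContinuousLinearMap.proj (R := ℂ) (φ := fun _ : Fin n => ℂ) (e j)))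

/-- **THE SUBSTRATE's `J`-LETTER IS `Δ_univ` — ENTIRE FACTOR** [folklore] (§1 + W39.1 `mixedLetter_rep_univ`): for radii `> 1` and `F : (J → ℂ) → ℂ`
jointly entire, `∫ wJ r q·F(sigmaJ r q) dlamJ(J) = Δ_univ (z ↦ F(z ∘ e))` for EVERY enumeration `e`. -/
theorem letterJ_rep (e : J ≃ Fin n) (r : J → ℝ) (hr : ∀ j, 1 < r j) (F : (J → ℂ) → ℂ) (hF : Differentiable ℂ F) :
    ∫ q, wJ r q * F (sigmaJ r q) ∂(lamJ J) = mixedDiff n Finset.univ fun z : Fin n → ℂ => F (z ∘ e) := by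
  rw [letterJ_eq_letter_fin e]
  exact mixedLetter_rep_univ _ (fun a => hr _) (fun z => F (z ∘ e)) (differentiable_reindex e hF)

/-- [folklore] Re-indexing maps the open `Fin n`-polydisc of radii `R ∘ e⁻¹` into the open `J`-polydisc of radii `R`, analytically. -/
theorem analyticOnNhd_reindex (e : J ≃ Fin n) {R : J → ℝ} {F : (J → ℂ) → ℂ}
    (hF : AnalyticOnNhd ℂ F (Set.univ.pi fun j => ball (0 : ℂ) (R j))) :
    AnalyticOnNhd ℂ (fun z : Fin n → ℂ => F (z ∘ e)) (Set.univ.pi fun a => ball (0 : ℂ) ((R ∘ e.symm) a)) := by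
  refine hF.comp (AnalyticOnNhd.pi fun j => (analyticOnNhd_apply (n := n) (e j)).mono (subset_univ _)) fun z hz => ?_
  exact Set.mem_univ_pi.2 fun j => by simpa using (Set.mem_univ_pi.1 hz) (e j)

/-- **THE SUBSTRATE's `J`-LETTER IS `Δ_univ` — LOCAL HYPOTHESIS** [folklore] (§1 + «SplitLocal» `mixedLetter_rep_of_split_local` at `S = univ`, W39.1
`pi_μS_univ`∕`wS_univ`∕`σS_univ`): for contour radii `1 < r_j < R_j` and `F` analytic on the open `J`-polydisc `Π_j{|z_j| < R_j}` ONLY. -/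
theorem letterJ_rep_local (e : J ≃ Fin n) {r R : J → ℝ} (hr : ∀ j, 1 < r j) (hR : ∀ j, r j < R j) (F : (J → ℂ) → ℂ)
    (hF : AnalyticOnNhd ℂ F (Set.univ.pi fun j => ball (0 : ℂ) (R j))) :
    ∫ q, wJ r q * F (sigmaJ r q) ∂(lamJ J) = mixedDiff n Finset.univ fun z : Fin n → ℂ => F (z ∘ e) := by
  rw [letterJ_eq_letter_fin e, ← pi_μS_univ, ← wS_univ, ← σS_univ]
  exact mixedLetter_rep_of_split_local (r := r ∘ e.symm) (R := R ∘ e.symm) (fun a => hr _) (fun a => hR _) Finset.univ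
    (fun z => F (z ∘ e)) (analyticOnNhd_reindex e hF)

/-! ## §3 ENUMERATION-FREE: the inclusion–exclusion sum over the `J`-indexed unit cube -/

/-- **THE SUBSTRATE's `J`-LETTER IN CLOSED FORM, NO ENUMERATION** [folklore] (§2 + W76 `mixedDiff_transport_eq_sum` at `S = univ`):
`∫ wJ r q·F(sigmaJ r q) dlamJ(J) = Σ_{T ⊆ J} (−1)^{#J − #T}·F(𝟙_T)` for `F` analytic on the open polydisc, radii `1 < r_j < R_j`. -/
theorem letterJ_eq_sum_local [DecidableEq J] {r R : J → ℝ} (hr : ∀ j, 1 < r j) (hR : ∀ j, r j < R j) (F : (J → ℂ) → ℂ)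
    (hF : AnalyticOnNhd ℂ F (Set.univ.pi fun j => ball (0 : ℂ) (R j))) :
    ∫ q, wJ r q * F (sigmaJ r q) ∂(lamJ J) =
      ∑ T ∈ (Finset.univ : Finset J).powerset, (-1 : ℂ) ^ (Fintype.card J - T.card) * F (fun j => if j ∈ T then (1 : ℂ) else 0) := by
  let e := Fintype.equivFin J
  have h := mixedDiff_transport_eq_sum e Finset.univ F
  rw [Finset.map_univ_equiv, Finset.card_univ] at h
  rw [letterJ_rep_local e hr hR F hF, h]

/-- **… SO NO NUMBERING OF THE CUBES MATTERS** [folklore]: two enumerations give the same `Δ_univ`. -/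
theorem letterJ_rep_indep (e e' : J ≃ Fin n) {r R : J → ℝ} (hr : ∀ j, 1 < r j) (hR : ∀ j, r j < R j) (F : (J → ℂ) → ℂ)
    (hF : AnalyticOnNhd ℂ F (Set.univ.pi fun j => ball (0 : ℂ) (R j))) :
    (mixedDiff n Finset.univ fun z : Fin n → ℂ => F (z ∘ e)) = mixedDiff n Finset.univ fun z : Fin n → ℂ => F (z ∘ e') := by
  rw [← letterJ_rep_local e hr hR F hF, ← letterJ_rep_local e' hr hR F hF]

/-! ## §4 (2.15)'s decay for the `J`-letter -/

/-- **`|∫ wJ·F∘sigmaJ dlamJ(J)| ≤ A·e^{−(κ₁−1)·#J}`** [folklore] (§2 + «SplitLocal» `norm_mixedDiff_le_lemma19` — Dimock's Lemma 19 BY NAME — at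
`S = univ` on the re-indexed factor): `κ₁ ≥ 1`, radii `1 < r_j < R_j`, `R_j > e^{κ₁}`, `‖F‖ ≤ A` on the closed `J`-polydisc `|z_j| ≤ e^{κ₁}`. -/
theorem norm_letterJ_le {r R : J → ℝ} {κ₁ A : ℝ} (hκ : 1 ≤ κ₁) (hr : ∀ j, 1 < r j) (hR : ∀ j, r j < R j)
    (hRe : ∀ j, Real.exp κ₁ < R j) (F : (J → ℂ) → ℂ) (hF : AnalyticOnNhd ℂ F (Set.univ.pi fun j => ball (0 : ℂ) (R j)))
    (hA : ∀ z ∈ polydisc (fun _ : J => Real.exp κ₁), ‖F z‖ ≤ A) :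
    ‖∫ q, wJ r q * F (sigmaJ r q) ∂(lamJ J)‖ ≤ A * Real.exp (-((κ₁ - 1) * Fintype.card J)) := by
  let e := Fintype.equivFin J
  rw [letterJ_rep_local e hr hR F hF]
  have h := norm_mixedDiff_le_lemma19 (R := R ∘ e.symm) hκ (fun a => hRe _) Finset.univ (analyticOnNhd_reindex e hF)
    fun z hz => hA _ fun j => by simpa using hz (e j)
  rwa [Finset.card_univ, Fintype.card_fin] at h

/-! ## §5 Decided check on a non-numeric index -/

/-- [folklore] Coordinate evaluation on a general finite index is analytic (Mathlib `ContinuousLinearMap.proj`). -/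
theorem analyticOnNhd_eval (j : J) (V : Set (J → ℂ)) : AnalyticOnNhd ℂ (fun z : J → ℂ => z j) V :=
  ((ContinuousLinearMap.proj (R := ℂ) (φ := fun _ : J => ℂ) j).analyticOnNhd V)


/-- DECIDED CHECK (`J = Bool`, no chosen numbering): for `F(z) = z true · z false` (entire) and radii `3∕2`, the substrate's two-variable letter is
the inclusion–exclusion sum `F(𝟙_{univ}) − F(𝟙_{true}) − F(𝟙_{false}) + F(𝟙_∅) = 1`. -/
example : ∫ q, wJ (fun _ : Bool => (3 / 2 : ℝ)) q * (sigmaJ (fun _ : Bool => (3 / 2 : ℝ)) q true * sigmaJ (fun _ => (3 / 2 : ℝ)) q false)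
    ∂(lamJ Bool) = 1 := by
  rw [letterJ_eq_sum_local (R := fun _ => 2) (fun _ => by norm_num) (fun _ => by norm_num) (fun z : Bool → ℂ => z true * z false)
    ((analyticOnNhd_eval true _).mul (analyticOnNhd_eval false _))]
  have hpow : (Finset.univ : Finset Bool).powerset = {∅, {true}, {false}, {true, false}} := by decide
  rw [hpow]
  simp

end Summit.QuantumFields.BalabanUV.T4Continuum.NE1p.DressedSmallFieldLetterTransport

end
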